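import Summits.QuantumFields.BalabanUV.Beta.D1BFx.NeedleGhostDipoleWord
import Summits.QuantumFields.BalabanUV.Beta.D1BFx.NeedleGhostTadpoleRowSharp
import Summits.QuantumFields.BalabanUV.Beta.D1BFx.NeedleProjNdlRow
import Summits.QuantumFields.BalabanUV.Beta.D1BFx.GluonNdlLocalRow

/-!
# `BalabanUV.Beta.D1BFx.NeedleGhostBubbleRowMass10` — road «BF-x» for binder row D1, slot (K), END row `hGrp gN`, (N-2) row «NT-4» WITH TOLERANCE `n¹⁰`
# (cell T₄-ii of `END-ii-SPEC.md` v1.1 §3 (c), owner ruling ρ-g11-11 (4)(c); an3-g65 census S-an3-g65-1 «REAL RE-COUNT … tolerance n⁶ ↦ n¹⁰ = the letter, ZERO room»):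
# **THE GHOST NEEDLE BUBBLE ROW `h₄` (`ghCur ⊗ qA` over the scalar ghost legs) FROM THE SCALING LETTER `|ωgh n·(cK n·cQ n)| ≤ k·n¹⁰`** — four powers sharper
# than the record's `NeedleGhostBubbleRowClosed.h₄_of_scaling` (tolerance `n⁶`), by (α) the needle's thinness under the base-point average (`Σ_b |q_b x| ≤ (n−1)·n⁻⁴`
# at a fixed site, M7) and (β) the dipole across the current's bond (FILE W `NeedleGhostDipoleWord.abs_T₄_le_needle_env`: one inverse power more per word)

HONEST DEPENDENCY (cell records, verbatim): «continuum YM on T⁴ ⇐ BetaPertH ∧ nine spine estimates (0/9 proved); BetaPertH ⇐ (D1) ∧ (D4) ∧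
CAP+tail; G-an2-4 gates asym, D1 and NE2/3/4.»  HONEST FRAMING (cell contract, verbatim): «discharging `BetaPertH` makes Bałaban's UV stability
UNCONDITIONAL — a real constructive-QFT result; it is NOT the continuum limit and NOT the Clay problem.»  THIS MODULE DISCHARGES NOTHING of the wall:
[folklore] lattice bookkeeping BY NAME over FILE W (the pointwise needle-site envelope), this lineage's gen-15 (1.22)-sum∕moment tools
(`NeedleProjNdlRow.abs_weight_le_of_mem_B`, `GluonNdlLocalRow.sum_moment_prof_le`, `LatticeHLSPairing.abs_fullSum_le_of_abs_sum_le`), M7 in the base-average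
form `NeedleGhostTadpoleRowSharp.sum_resSite_abs_qJetAt_le` ∕ `blk_resSite`.  No `def`, no `def … : Prop`, nothing cited, 0 sorry.  THE SCALING LETTER
`|ωgh n·(cK n·cQ n)| ≤ k·n¹⁰` IS A DISPLAYED HYPOTHESIS on ARBITRARY weight sequences, ruled nowhere in this file; nothing about Bałaban's operators is asserted.
END-AGNOSTIC: no `hω`, no `s`, no END-ii name.  READING NOTE (owner rulings ρ-g11-9∕ρ-g11-11, an3 X31 table): under the END of record's `hω` (reading (i))
the letter of `h₄` reads `4N²a·n⁶` (`NeedleRowsAtRay.abs_weight₄_le_of_ray`); under the physical reading (ii) ∕ ENDₛ at `s n = n⁻²` it reads `4N²a·n¹⁰` — THIS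
file is the count that meets the latter; END-ii ∕ ENDₛ themselves are NOT in the tree.  Root-level binders hW ∕ hR-sockets ∕ hSX-socket ∕ D1Tel ∕ D1Rep — 0
discharged; (K) NOT closed; NOT D1, NOT `BetaPertH`, NOT continuum, NOT Clay.

ABSOLUTE RULE (cell charter, verbatim): «No internally-minted statement may enter as a cited fact. Every hypothesis is either kernel-proved in this
package or a verbatim quotation of a PUBLISHED theorem with page reference. The manuscript(s) under audit are NOT citable for their own disputed
steps — they are the thing under adjudication; programme-internal (2001/route/tribunal) claims are never citable.»

LEDGER (an3-g65 census, confirmed): per base bond `b`, `|n⁻⁸·fullSum_b| ≤ n⁻⁸·(Σ_{x∈B(blk b)}|q_b x|)·Mg(n)` with `Mg(n) = n⁻²·(cNear·A₁·P₃(n) + (cNear1∕n)·A₀·P₂(n))`,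
`P₃ = O(n³)`, `P₂ = O(n⁴)` the centred weighted moments of `e∕nrm³`, `e∕nrm²` (`sum_moment_prof_le`) ⇒ `Mg = O(n)`; base average `n⁻⁴·Σ_b Σ_x |q_b x| ≤ n⁻⁴·(n−1)`;
total `n⁻⁸·n⁻⁴·(n−1)·O(n) = O(n⁻¹⁰)` against the letter `k·n¹⁰`.
CONTENT (all [folklore]):
* §1 `abs_fullSum_le_of_base_weight_envelope` — the (1.22) sum at one base site from a needle-site envelope rooted AT THE BASE (generic nonneg weights `q` on `B(blk b)`;
  the `qJet` instance is gen-15's `NeedleDipNdlRow.abs_fullSum_le_of_base_needle_envelope`).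
* §2 `env_nonneg`, `env_even`, `moment_env_le` (the envelope's centred weighted moment `≤ Mg(n)`), **`abs_fullSum_T₄_le₁₀`**.
* §3 `sum_resSite_needle_mass_le` (`Σ_b Σ_{x∈B 0} |qJetAt (ctrHalf n) n ν b 0 x| ≤ n − 1`), **`abs_row₄_le₁₀`**.
* §4 **`h₄_of_scaling₁₀ (ha) (hk : ∀ n ≥ 2, |ωgh n·(cK n·cQ n)| ≤ k·n¹⁰) ⊢ h₄`** VERBATIM (`NeedleRowGlue.abs_gN_row_le_of_tables`'s row), `C₄` explicit and n-free.
NOT HERE (honest): T₅-ii (the mirror — companion file), T₆-ii (an3's re-routing recipe; NT lineage ∕ owner), any END-ii name.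
Unit `b2b-balaban-beta-d1-formalise-leaf-01` (gen 16), D1 formalisation swarm LEAF PROVER 01; `LEAVES-BFx.md` row (N) ∕ (N-2) «NT-4», cell T₄-ii.
-/

noncomputable section

namespace Summit.QuantumFields.BalabanUV.Beta.D1BFx.NeedleGhostBubbleRowMass10

open Finset Real
open scoped BigOperators
open Literature.MathematicalPhysics.QuantumFieldTheory.Balaban1983to89
open Literature.MathematicalPhysics.QuantumFieldTheory.Balaban1983to89.Beta
open B6QGQLower276 (blk B mem_B)
open B6QGQDecay237 (card_B)
open Beta.PoissonInterior (nrm one_le_nrm nrm_pos nrm_neg)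
open DyadicShell (Pt toReal supNorm)
open ExpKernelCalculus (Site MKer)
open WindowIdentification (fullSum)
open DressedMomentNormalisation (resSite)
open GhostStencil (ghCur)
open Summit.QuantumFields.BalabanUV.Beta.D1BFx.FineHessianSectors (biBubbleTable)
open Summit.QuantumFields.BalabanUV.Beta.D1BFx.GhostStencilRooted (qJetAt qAntiAt)
open Summit.QuantumFields.BalabanUV.Beta.D1BFx.GhostStencilRootedReflection (ctrHalf ctrHalf_mem)
open Summit.QuantumFields.BalabanUV.Beta.D1BFx.GhostLeg (Ggh cast_pred_add_one)
open Summit.QuantumFields.BalabanUV.Beta.D1BFx.PointColumnSplit (cG0 cG0_nonneg cSplit cSplit_nonneg)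
open Summit.QuantumFields.BalabanUV.Beta.D1BFx.GhostLegFree (ghA0 ghA1 ghDelta ghDelta_pos supNorm_eq)
open Summit.QuantumFields.BalabanUV.Beta.D1BFx.GhostLegBlockMass (cNear ghA0_pos)
open Summit.QuantumFields.BalabanUV.Beta.D1BFx.GhostLegBlockMassD1 (cNear1 ghA1_nonneg)
open Summit.QuantumFields.BalabanUV.Beta.D1BFx.NeedleGhostDipoleWord (abs_R_diff_le abs_T₄_le_needle_env)
open Summit.QuantumFields.BalabanUV.Beta.D1BFx.RColumnBlockMass (cNear_nonneg cNear1_nonneg)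
open Summit.QuantumFields.BalabanUV.Beta.D1BFx.NeedleGhostTadpoleRowSharp (blk_resSite sum_resSite_abs_qJetAt_le)
open Summit.QuantumFields.BalabanUV.Beta.D1BFx.NeedleProjNdlRow (abs_weight_le_of_mem_B)
open Summit.QuantumFields.BalabanUV.Beta.D1BFx.LatticeHLSPairing (abs_fullSum_le_of_abs_sum_le)
open Summit.QuantumFields.BalabanUV.Beta.D1BFx.GluonNdlLocalRow (sum_moment_prof_le)

variable (n : ℕ) [NeZero n] {a : ℝ}

/-! ## §1 The (1.22) sum at one base site from a needle-site envelope rooted at the base (generic weights) -/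

/-- [folklore] **THE (1.22) SUM FROM A BASE-ROOTED SITE ENVELOPE** (generic nonneg weights `q` on the base block): if `|T w| ≤ Σ_{s∈B(blk b)} q s·G(b+w−s)` with `G ≥ 0` even
and `Σ_{w∈S}(2‖c−w‖²+2n²)·G(c−w) ≤ Mg` for every centre `c` and finite `S`, then `|fullSum (w ↦ w_μw_ν·T w)| ≤ (Σ_{s∈B(blk b)} q s)·Mg`. -/
theorem abs_fullSum_le_of_base_weight_envelope {T G q : Pt → ℝ} {Mg : ℝ} (b : Pt) (hq : ∀ s, 0 ≤ q s) (hG0 : ∀ t, 0 ≤ G t) (hGev : ∀ t, G (-t) = G t)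
    (hT : ∀ w : Pt, |T w| ≤ ∑ s ∈ B (n - 1) (blk (n - 1) b), q s * G (b + w - s))
    (hmom : ∀ (c : Pt) (S : Finset Pt), ∑ w ∈ S, (2 * (PoissonInterior.supNorm (d := 4) (c - w) : ℝ) ^ 2 + 2 * (n : ℝ) ^ 2) * G (c - w) ≤ Mg)
    (μ ν : Fin 4) :
    |fullSum (fun w : Pt => toReal w μ * toReal w ν * T w)| ≤ (∑ s ∈ B (n - 1) (blk (n - 1) b), q s) * Mg := by
  have hMg : 0 ≤ Mg := le_trans (Finset.sum_nonneg fun w _ => mul_nonneg (by positivity) (hG0 _)) (hmom b ∅)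
  have hfin : ∀ S : Finset Pt, ∑ w ∈ S, |toReal w μ * toReal w ν * T w| ≤ (∑ s ∈ B (n - 1) (blk (n - 1) b), q s) * Mg := by
    intro S
    calc ∑ w ∈ S, |toReal w μ * toReal w ν * T w|
        ≤ ∑ w ∈ S, ∑ s ∈ B (n - 1) (blk (n - 1) b), |toReal w μ * toReal w ν| * (q s * G (b + w - s)) := by
          refine Finset.sum_le_sum fun w _ => ?_
          rw [abs_mul, ← Finset.mul_sum]
          exact mul_le_mul_of_nonneg_left (hT w) (abs_nonneg _)
      _ = ∑ s ∈ B (n - 1) (blk (n - 1) b), ∑ w ∈ S, |toReal w μ * toReal w ν| * (q s * G (b + w - s)) := Finset.sum_comm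
      _ ≤ ∑ s ∈ B (n - 1) (blk (n - 1) b), ∑ w ∈ S, (2 * (PoissonInterior.supNorm (d := 4) ((s - b) - w) : ℝ) ^ 2 + 2 * (n : ℝ) ^ 2) *
            (q s * G ((s - b) - w)) := by
          refine Finset.sum_le_sum fun s hs => Finset.sum_le_sum fun w _ => ?_
          have e1 : b + w - s = -((s - b) - w) := by abel
          have e2 : (PoissonInterior.supNorm (d := 4) (b + w - s) : ℝ) = PoissonInterior.supNorm (d := 4) ((s - b) - w) := by
            rw [e1, PoissonInterior.supNorm_neg]
          rw [e1, hGev, ← e2]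
          exact mul_le_mul_of_nonneg_right (abs_weight_le_of_mem_B n b w s hs μ ν) (mul_nonneg (hq _) (hG0 _))
      _ = ∑ s ∈ B (n - 1) (blk (n - 1) b), q s *
            ∑ w ∈ S, (2 * (PoissonInterior.supNorm (d := 4) ((s - b) - w) : ℝ) ^ 2 + 2 * (n : ℝ) ^ 2) * G ((s - b) - w) := by
          refine Finset.sum_congr rfl fun s _ => ?_
          rw [Finset.mul_sum]; exact Finset.sum_congr rfl fun w _ => by ring
      _ ≤ ∑ s ∈ B (n - 1) (blk (n - 1) b), q s * Mg :=
          Finset.sum_le_sum fun s _ => mul_le_mul_of_nonneg_left (hmom (s - b) S) (hq _)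
      _ = _ := by rw [Finset.sum_mul]
  exact (abs_fullSum_le_of_abs_sum_le hfin).2

/-! ## §2 The dipole envelope's moment and the (1.22) sum of T₄ at one base bond -/

/-- [folklore] The dipole envelope is nonnegative. -/
theorem env_nonneg (ha : 0 < a) (v : Pt) : 0 ≤ (((n : ℝ) ^ 2)⁻¹ * (cNear a * (ghA1 a + 2 * (cG0 4 + cSplit 4 a)) * (Real.exp (-(ghDelta a / n) * supNorm v) / nrm v ^ 3) + cNear1 a / n * (ghA0 a + (cG0 4 + cSplit 4 a)) * (Real.exp (-(ghDelta a / n) * supNorm v) / nrm v ^ 2))) := by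
  have hn : (0 : ℝ) < n := by exact_mod_cast Nat.pos_of_ne_zero (NeZero.ne n)
  have h1 := cNear_nonneg ha
  have h2 : 0 ≤ cNear1 a / n := by
    have h := abs_R_diff_le n ha (0 : Pt) (0 : Pt) 0
    exact (abs_nonneg _).trans h
  have h3 : 0 ≤ ghA1 a + 2 * (cG0 4 + cSplit 4 a) := by
    have := ghA1_nonneg ha; have := cG0_nonneg 4; have := cSplit_nonneg 4 ha; linarith
  have h4 : 0 ≤ ghA0 a + (cG0 4 + cSplit 4 a) := by
    have := (ghA0_pos ha).le; have := cG0_nonneg 4; have := cSplit_nonneg 4 ha; linarith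
  have h5 := nrm_pos v
  positivity

omit [NeZero n] in
/-- [folklore] The dipole envelope is even. -/
theorem env_even (v : Pt) : (((n : ℝ) ^ 2)⁻¹ * (cNear a * (ghA1 a + 2 * (cG0 4 + cSplit 4 a)) * (Real.exp (-(ghDelta a / n) * supNorm (-v)) / nrm (-v) ^ 3) + cNear1 a / n * (ghA0 a + (cG0 4 + cSplit 4 a)) * (Real.exp (-(ghDelta a / n) * supNorm (-v)) / nrm (-v) ^ 2))) = (((n : ℝ) ^ 2)⁻¹ * (cNear a * (ghA1 a + 2 * (cG0 4 + cSplit 4 a)) * (Real.exp (-(ghDelta a / n) * supNorm v) / nrm v ^ 3) + cNear1 a / n * (ghA0 a + (cG0 4 + cSplit 4 a)) * (Real.exp (-(ghDelta a / n) * supNorm v) / nrm v ^ 2))) := by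
  have e1 : supNorm (-v) = supNorm v := PoissonInterior.supNorm_neg (d := 4) v
  rw [e1, nrm_neg]

/-- [folklore] **THE CENTRED WEIGHTED MOMENT OF THE DIPOLE ENVELOPE IS `O(n)`**: with `P₃`, `P₂` the right-hand sides of `sum_moment_prof_le` at `p = 3, 2` (rate `ghDelta a`),
`Σ_{w∈S}(2‖c−w‖²+2n²)·G(c−w) ≤ Mg(n) := n⁻²·(cNear·A₁·P₃(n) + (cNear1∕n)·A₀·P₂(n))`. -/
theorem moment_env_le (ha : 0 < a) (c : Pt) (S : Finset Pt) :
    ∑ w ∈ S, (2 * (PoissonInterior.supNorm (d := 4) (c - w) : ℝ) ^ 2 + 2 * (n : ℝ) ^ 2) * (((n : ℝ) ^ 2)⁻¹ * (cNear a * (ghA1 a + 2 * (cG0 4 + cSplit 4 a)) * (Real.exp (-(ghDelta a / n) * supNorm (c - w)) / nrm (c - w) ^ 3) + cNear1 a / n * (ghA0 a + (cG0 4 + cSplit 4 a)) * (Real.exp (-(ghDelta a / n) * supNorm (c - w)) / nrm (c - w) ^ 2)))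
      ≤ ((n : ℝ) ^ 2)⁻¹ * (cNear a * (ghA1 a + 2 * (cG0 4 + cSplit 4 a)) * (2 * (2 * (Nat.factorial 2) * (2 / ghDelta a) ^ 2 * (1 + 2 * (4 : ℕ) * 3 ^ (4 - 1) * ((Nat.factorial (4 - 1 - 3)) * (4 / ghDelta a) ^ (4 - 1 - 3) * (1 + 4 / ghDelta a))) * (n : ℝ) ^ (4 - 3 + 2)) + 2 * (n : ℝ) ^ 2 * (2 * (Nat.factorial 0) * (2 / ghDelta a) ^ 0 * (1 + 2 * (4 : ℕ) * 3 ^ (4 - 1) * ((Nat.factorial (4 - 1 - 3)) * (4 / ghDelta a) ^ (4 - 1 - 3) * (1 + 4 / ghDelta a))) * (n : ℝ) ^ (4 - 3 + 0))) + cNear1 a / n * (ghA0 a + (cG0 4 + cSplit 4 a)) * (2 * (2 * (Nat.factorial 2) * (2 / ghDelta a) ^ 2 * (1 + 2 * (4 : ℕ) * 3 ^ (4 - 1) * ((Nat.factorial (4 - 1 - 2)) * (4 / ghDelta a) ^ (4 - 1 - 2) * (1 + 4 / ghDelta a))) * (n : ℝ) ^ (4 - 2 + 2)) + 2 * (n :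 ℝ) ^ 2 * (2 * (Nat.factorial 0) * (2 / ghDelta a) ^ 0 * (1 + 2 * (4 : ℕ) * 3 ^ (4 - 1) * ((Nat.factorial (4 - 1 - 2)) * (4 / ghDelta a) ^ (4 - 1 - 2) * (1 + 4 / ghDelta a))) * (n : ℝ) ^ (4 - 2 + 0)))) := by
  have hn : (0 : ℝ) < n := by exact_mod_cast Nat.pos_of_ne_zero (NeZero.ne n)
  have hδ := ghDelta_pos ha
  have h3 := sum_moment_prof_le (n := n) hδ (p := 3) le_rfl c S
  have h2 := sum_moment_prof_le (n := n) hδ (p := 2) (by norm_num) c S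
  have hc1 := cNear_nonneg ha
  have hc2 : 0 ≤ cNear1 a / n := by
    have h := abs_R_diff_le n ha (0 : Pt) (0 : Pt) 0
    exact (abs_nonneg _).trans h
  have hA1 : 0 ≤ ghA1 a + 2 * (cG0 4 + cSplit 4 a) := by
    have := ghA1_nonneg ha; have := cG0_nonneg 4; have := cSplit_nonneg 4 ha; linarith
  have hA0 : 0 ≤ ghA0 a + (cG0 4 + cSplit 4 a) := by
    have := (ghA0_pos ha).le; have := cG0_nonneg 4; have := cSplit_nonneg 4 ha; linarith
  -- split the sum into the two profile classes and pull the constants out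
  have e : ∀ w : Pt, (2 * (PoissonInterior.supNorm (d := 4) (c - w) : ℝ) ^ 2 + 2 * (n : ℝ) ^ 2) * (((n : ℝ) ^ 2)⁻¹ * (cNear a * (ghA1 a + 2 * (cG0 4 + cSplit 4 a)) * (Real.exp (-(ghDelta a / n) * supNorm (c - w)) / nrm (c - w) ^ 3) + cNear1 a / n * (ghA0 a + (cG0 4 + cSplit 4 a)) * (Real.exp (-(ghDelta a / n) * supNorm (c - w)) / nrm (c - w) ^ 2)))
      = ((n : ℝ) ^ 2)⁻¹ * (cNear a * (ghA1 a + 2 * (cG0 4 + cSplit 4 a))) *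
          ((2 * (PoissonInterior.supNorm (d := 4) (c - w) : ℝ) ^ 2 + 2 * (n : ℝ) ^ 2) *
            (Real.exp (-(ghDelta a / n) * PoissonInterior.supNorm (d := 4) (c - w)) / nrm (c - w) ^ 3))
        + ((n : ℝ) ^ 2)⁻¹ * (cNear1 a / n * (ghA0 a + (cG0 4 + cSplit 4 a))) *
          ((2 * (PoissonInterior.supNorm (d := 4) (c - w) : ℝ) ^ 2 + 2 * (n : ℝ) ^ 2) *
            (Real.exp (-(ghDelta a / n) * PoissonInterior.supNorm (d := 4) (c - w)) / nrm (c - w) ^ 2)) := by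
    intro w; rw [supNorm_eq]; ring
  rw [Finset.sum_congr rfl fun w _ => e w, Finset.sum_add_distrib, ← Finset.mul_sum, ← Finset.mul_sum]
  have hL := mul_le_mul_of_nonneg_left h3 (show 0 ≤ ((n : ℝ) ^ 2)⁻¹ * (cNear a * (ghA1 a + 2 * (cG0 4 + cSplit 4 a))) by positivity)
  have hR := mul_le_mul_of_nonneg_left h2 (show 0 ≤ ((n : ℝ) ^ 2)⁻¹ * (cNear1 a / n * (ghA0 a + (cG0 4 + cSplit 4 a))) by positivity)
  refine (add_le_add hL hR).trans (le_of_eq ?_)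
  ring

/-- [folklore] **THE (1.22) SUM OF T₄ AT ONE BASE BOND**: for every root `ρ`,
`|fullSum (w ↦ w_μw_ν·T₄(b+w,b))| ≤ (Σ_{x∈B(blk b)} |qJetAt ρ n ν b (blk b) x|)·Mg(n)`. -/
theorem abs_fullSum_T₄_le₁₀ (ha : 0 < a) (ρ : Site 4) (b : Pt) (μ ν : Fin 4) :
    |fullSum (fun w : Pt => toReal w μ * toReal w ν *
        biBubbleTable (Ggh n a) (Ggh n a) ghCur (qAntiAt ρ n) μ ν (b + w) b)|
      ≤ (∑ x ∈ B (n - 1) (blk (n - 1) b), |qJetAt ρ n ν b (blk (n - 1) b) x|) * (((n : ℝ) ^ 2)⁻¹ * (cNear a * (ghA1 a + 2 * (cG0 4 + cSplit 4 a)) * (2 * (2 * (Nat.factorial 2) * (2 / ghDelta a) ^ 2 * (1 + 2 * (4 : ℕ) * 3 ^ (4 - 1) * ((Nat.factorial (4 - 1 - 3)) * (4 / ghDelta a) ^ (4 - 1 - 3) * (1 + 4 / ghDelta a))) * (n : ℝ) ^ (4 - 3 + 2)) + 2 * (n : ℝ) ^ 2 * (2 * (Nat.factorial 0) * (2 / ghDelta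 a) ^ 0 * (1 + 2 * (4 : ℕ) * 3 ^ (4 - 1) * ((Nat.factorial (4 - 1 - 3)) * (4 / ghDelta a) ^ (4 - 1 - 3) * (1 + 4 / ghDelta a))) * (n : ℝ) ^ (4 - 3 + 0))) + cNear1 a / n * (ghA0 a + (cG0 4 + cSplit 4 a)) * (2 * (2 * (Nat.factorial 2) * (2 / ghDelta a) ^ 2 * (1 + 2 * (4 : ℕ) * 3 ^ (4 - 1) * ((Nat.factorial (4 - 1 - 2)) * (4 / ghDelta a) ^ (4 - 1 - 2) * (1 + 4 / ghDelta a))) * (n : ℝ) ^ (4 - 2 + 2)) + 2 * (n : ℝ) ^ 2 * (2 * (Nat.factorial 0) * (2 / ghDelta a) ^ 0 * (1 + 2 * (4 : ℕ) * 3 ^ (4 - 1) * ((Nat.factorial (4 - 1 - 2)) * (4 / ghDelta a) ^ (4 - 1 - 2) * (1 + 4 / ghDelta a))) * (n : ℝ) ^ (4 - 2 + 0))))) :=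
  abs_fullSum_le_of_base_weight_envelope n b (fun _ => abs_nonneg _) (env_nonneg n ha) (env_even n)
    (fun w => abs_T₄_le_needle_env n ha ρ μ ν (b + w) b) (moment_env_le n ha) μ ν

/-! ## §3 The base-point average -/

/-- [folklore] **THE NEEDLE MASS SUMMED OVER THE BASE BONDS OF THE BLOCK OF THE ORIGIN IS `≤ n − 1`** (M7 at each of the `n⁴` sites of the block). -/
theorem sum_resSite_needle_mass_le (ν : Fin 4) :
    ∑ b ∈ (univ : Finset (Fin 4 → Fin n)).image resSite, ∑ x ∈ B (n - 1) (blk (n - 1) b), |qJetAt (ctrHalf n) n ν b (blk (n - 1) b) x| ≤ (n : ℝ) - 1 := by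
  have hn : (0 : ℝ) < n := by exact_mod_cast Nat.pos_of_ne_zero (NeZero.ne n)
  calc ∑ b ∈ (univ : Finset (Fin 4 → Fin n)).image resSite, ∑ x ∈ B (n - 1) (blk (n - 1) b), |qJetAt (ctrHalf n) n ν b (blk (n - 1) b) x|
      = ∑ b ∈ (univ : Finset (Fin 4 → Fin n)).image resSite, ∑ x ∈ B (n - 1) 0, |qJetAt (ctrHalf n) n ν b 0 x| := by
        refine Finset.sum_congr rfl fun b hb => ?_
        obtain ⟨r, _, rfl⟩ := Finset.mem_image.1 hb
        rw [blk_resSite]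
    _ = ∑ x ∈ B (n - 1) 0, ∑ b ∈ (univ : Finset (Fin 4 → Fin n)).image resSite, |qJetAt (ctrHalf n) n ν b 0 x| := Finset.sum_comm
    _ ≤ ∑ _x ∈ B (n - 1) (0 : Pt), ((n : ℝ) - 1) * ((n : ℝ) ^ 4)⁻¹ := Finset.sum_le_sum fun x _ => sum_resSite_abs_qJetAt_le n ν x
    _ = (n : ℝ) - 1 := by rw [Finset.sum_const, nsmul_eq_mul, card_B, cast_pred_add_one n]; field_simp

/-- [folklore] **THE ROW BOUND AT FIXED `n`** (weight `ω` arbitrary): `|ω·Σ_b n⁻⁴·(n⁻⁸·fullSum_b)| ≤ |ω|·(n⁻⁴·(n⁻⁸·((n−1)·Mg(n))))`. -/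
theorem abs_row₄_le₁₀ (ha : 0 < a) (ω : ℝ) (μ ν : Fin 4) :
    |ω * ∑ b ∈ (univ : Finset (Fin 4 → Fin n)).image resSite, ((n : ℝ) ^ 4)⁻¹ *
        (((n : ℝ) ^ 8)⁻¹ * fullSum (fun w : Pt => toReal w μ * toReal w ν *
          biBubbleTable (Ggh n a) (Ggh n a) ghCur (qAntiAt (ctrHalf n) n) μ ν (b + w) b))|
      ≤ |ω| * (((n : ℝ) ^ 4)⁻¹ * (((n : ℝ) ^ 8)⁻¹ * (((n : ℝ) - 1) * (((n : ℝ) ^ 2)⁻¹ * (cNear a * (ghA1 a + 2 * (cG0 4 + cSplit 4 a)) * (2 * (2 * (Nat.factorial 2) * (2 / ghDelta a) ^ 2 * (1 + 2 * (4 : ℕ) * 3 ^ (4 - 1) * ((Nat.factorial (4 - 1 - 3)) * (4 / ghDelta a) ^ (4 - 1 - 3) * (1 + 4 / ghDelta a))) * (n : ℝ) ^ (4 - 3 + 2)) + 2 * (n : ℝ) ^ 2 * (2 * (Nat.factorial 0) * (2 / ghDelta a) ^ 0 * (1 + 2 * (4 : ℕ) * 3 ^ (4 - 1) * ((Nat.factorial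 (4 - 1 - 3)) * (4 / ghDelta a) ^ (4 - 1 - 3) * (1 + 4 / ghDelta a))) * (n : ℝ) ^ (4 - 3 + 0))) + cNear1 a / n * (ghA0 a + (cG0 4 + cSplit 4 a)) * (2 * (2 * (Nat.factorial 2) * (2 / ghDelta a) ^ 2 * (1 + 2 * (4 : ℕ) * 3 ^ (4 - 1) * ((Nat.factorial (4 - 1 - 2)) * (4 / ghDelta a) ^ (4 - 1 - 2) * (1 + 4 / ghDelta a))) * (n : ℝ) ^ (4 - 2 + 2)) + 2 * (n : ℝ) ^ 2 * (2 * (Nat.factorial 0) * (2 / ghDelta a) ^ 0 * (1 + 2 * (4 : ℕ) * 3 ^ (4 - 1) * ((Nat.factorial (4 - 1 - 2)) * (4 / ghDelta a) ^ (4 - 1 - 2) * (1 + 4 / ghDelta a))) * (n : ℝ) ^ (4 - 2 + 0)))))))) := by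
  have hn : (0 : ℝ) < n := by exact_mod_cast Nat.pos_of_ne_zero (NeZero.ne n)
  set Mg := ((n : ℝ) ^ 2)⁻¹ * (cNear a * (ghA1 a + 2 * (cG0 4 + cSplit 4 a)) * (2 * (2 * (Nat.factorial 2) * (2 / ghDelta a) ^ 2 * (1 + 2 * (4 : ℕ) * 3 ^ (4 - 1) * ((Nat.factorial (4 - 1 - 3)) * (4 / ghDelta a) ^ (4 - 1 - 3) * (1 + 4 / ghDelta a))) * (n : ℝ) ^ (4 - 3 + 2)) + 2 * (n : ℝ) ^ 2 * (2 * (Nat.factorial 0) * (2 / ghDelta a) ^ 0 * (1 + 2 * (4 : ℕ) * 3 ^ (4 - 1) * ((Nat.factorial (4 - 1 - 3)) * (4 / ghDelta a) ^ (4 - 1 - 3) * (1 + 4 / ghDelta a))) * (n : ℝ) ^ (4 - 3 + 0))) + cNear1 a / n * (ghA0 a + (cG0 4 + cSplit 4 a)) * (2 * (2 * (Nat.factorial 2) * (2 / ghDelta a) ^ 2 * (1 + 2 * (4 : ℕ) * 3 ^ (4 - 1) * ((Nat.factorial (4 - 1 - 2)) * (4 / ghDelta a) ^ (4 - 1 -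 2) * (1 + 4 / ghDelta a))) * (n : ℝ) ^ (4 - 2 + 2)) + 2 * (n : ℝ) ^ 2 * (2 * (Nat.factorial 0) * (2 / ghDelta a) ^ 0 * (1 + 2 * (4 : ℕ) * 3 ^ (4 - 1) * ((Nat.factorial (4 - 1 - 2)) * (4 / ghDelta a) ^ (4 - 1 - 2) * (1 + 4 / ghDelta a))) * (n : ℝ) ^ (4 - 2 + 0)))) with hMg
  have hMg0 : 0 ≤ Mg := le_trans (Finset.sum_nonneg fun w _ => mul_nonneg (by positivity) (env_nonneg n ha _)) (moment_env_le n ha 0 ∅)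
  have hb : ∀ b : Pt, |((n : ℝ) ^ 4)⁻¹ * (((n : ℝ) ^ 8)⁻¹ * fullSum (fun w : Pt => toReal w μ * toReal w ν *
      biBubbleTable (Ggh n a) (Ggh n a) ghCur (qAntiAt (ctrHalf n) n) μ ν (b + w) b))|
      ≤ ((n : ℝ) ^ 4)⁻¹ * (((n : ℝ) ^ 8)⁻¹ * ((∑ x ∈ B (n - 1) (blk (n - 1) b), |qJetAt (ctrHalf n) n ν b (blk (n - 1) b) x|) * Mg)) := by
    intro b
    rw [abs_mul, abs_mul, abs_of_nonneg (by positivity : (0 : ℝ) ≤ ((n : ℝ) ^ 4)⁻¹), abs_of_nonneg (by positivity : (0 : ℝ) ≤ ((n : ℝ) ^ 8)⁻¹)]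
    exact mul_le_mul_of_nonneg_left (mul_le_mul_of_nonneg_left (abs_fullSum_T₄_le₁₀ n ha (ctrHalf n) b μ ν) (by positivity)) (by positivity)
  rw [abs_mul]
  refine mul_le_mul_of_nonneg_left ?_ (abs_nonneg _)
  calc |∑ b ∈ (univ : Finset (Fin 4 → Fin n)).image resSite, ((n : ℝ) ^ 4)⁻¹ * (((n : ℝ) ^ 8)⁻¹ * fullSum (fun w : Pt => toReal w μ * toReal w ν *
          biBubbleTable (Ggh n a) (Ggh n a) ghCur (qAntiAt (ctrHalf n) n) μ ν (b + w) b))|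
      ≤ ∑ b ∈ (univ : Finset (Fin 4 → Fin n)).image resSite, ((n : ℝ) ^ 4)⁻¹ * (((n : ℝ) ^ 8)⁻¹ *
          ((∑ x ∈ B (n - 1) (blk (n - 1) b), |qJetAt (ctrHalf n) n ν b (blk (n - 1) b) x|) * Mg)) :=
        (Finset.abs_sum_le_sum_abs _ _).trans (Finset.sum_le_sum fun b _ => hb b)
    _ = ((n : ℝ) ^ 4)⁻¹ * (((n : ℝ) ^ 8)⁻¹ * ((∑ b ∈ (univ : Finset (Fin 4 → Fin n)).image resSite,
          ∑ x ∈ B (n - 1) (blk (n - 1) b), |qJetAt (ctrHalf n) n ν b (blk (n - 1) b) x|) * Mg)) := by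
        rw [Finset.sum_mul, Finset.mul_sum, Finset.mul_sum]
    _ ≤ ((n : ℝ) ^ 4)⁻¹ * (((n : ℝ) ^ 8)⁻¹ * (((n : ℝ) - 1) * Mg)) :=
        mul_le_mul_of_nonneg_left (mul_le_mul_of_nonneg_left (mul_le_mul_of_nonneg_right (sum_resSite_needle_mass_le n ν) hMg0)
          (by positivity)) (by positivity)

/-! ## §4 «NT-4» with tolerance `n¹⁰`, in the glue's currency -/

variable {n} in
/-- [folklore] **«NT-4» WITH TOLERANCE `n¹⁰`**: `(ha : 0 < a) (hk : ∀ n ≥ 2, |ωgh n·(cK n·cQ n)| ≤ k·n¹⁰)` ⊢ the row `h₄` (`ghCur ⊗ qA` over `Ggh`) of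
`NeedleRowGlue.abs_gN_row_le_of_tables` VERBATIM, with the n-FREE constant
`C₄ := k·(cNear a·A₁·(2α₃ + 2β₃) + cNear1 a·A₀·(2α₂ + 2β₂))`, `A₁ = ghA1 a + 2(cG0 4 + cSplit 4 a)`, `A₀ = ghA0 a + (cG0 4 + cSplit 4 a)`, `α_p, β_p` the two
profile brackets of `sum_moment_prof_le` at rate `ghDelta a` — four powers of `n` sharper than the record's `h₄_of_scaling` (tolerance `n⁶`); met at the
END-ii ray with `k := 4N²a`. -/
theorem h₄_of_scaling₁₀ {k : ℝ} {cK cQ ωgh : ℕ → ℝ} (ha : 0 < a) (hk : ∀ n : ℕ, 2 ≤ n → |ωgh n * (cK n * cQ n)| ≤ k * (n : ℝ) ^ 10) (μ ν : Fin 4) :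
    ∀ n : ℕ, 2 ≤ n → ∀ [NeZero n], |ωgh n * (cK n * cQ n) * ∑ b ∈ (univ : Finset (Fin 4 → Fin n)).image resSite, ((n : ℝ) ^ 4)⁻¹ *
      (((n : ℝ) ^ 8)⁻¹ * fullSum (fun w : Pt => toReal w μ * toReal w ν *
        biBubbleTable (Ggh n a) (Ggh n a) ghCur (qAntiAt (ctrHalf n) n) μ ν (b + w) b))|
        ≤ k * (cNear a * (ghA1 a + 2 * (cG0 4 + cSplit 4 a)) * (2 * (2 * (Nat.factorial 2) * (2 / ghDelta a) ^ 2 * (1 + 2 * (4 : ℕ) * 3 ^ (4 - 1) * ((Nat.factorial (4 - 1 - 3)) * (4 / ghDelta a) ^ (4 - 1 - 3) * (1 + 4 / ghDelta a)))) + 2 * (2 * (Nat.factorial 0) * (2 / ghDelta a) ^ 0 * (1 + 2 * (4 : ℕ) * 3 ^ (4 - 1) * ((Nat.factorial (4 - 1 - 3)) * (4 / ghDelta a) ^ (4 - 1 - 3) * (1 + 4 / ghDelta a))))) + cNear1 a * (ghA0 a + (cG0 4 + cSplit 4 a)) * (2 * (2 * (Nat.factorial 2) * (2 / ghDelta a)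 ^ 2 * (1 + 2 * (4 : ℕ) * 3 ^ (4 - 1) * ((Nat.factorial (4 - 1 - 2)) * (4 / ghDelta a) ^ (4 - 1 - 2) * (1 + 4 / ghDelta a)))) + 2 * (2 * (Nat.factorial 0) * (2 / ghDelta a) ^ 0 * (1 + 2 * (4 : ℕ) * 3 ^ (4 - 1) * ((Nat.factorial (4 - 1 - 2)) * (4 / ghDelta a) ^ (4 - 1 - 2) * (1 + 4 / ghDelta a)))))) := by
  intro n hn _
  have hn0 : (0 : ℝ) < n := by exact_mod_cast (show 0 < n by omega)
  have hrow := abs_row₄_le₁₀ n ha (ωgh n * (cK n * cQ n)) μ ν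
  have hω := hk n hn
  have hkn : 0 ≤ k * (n : ℝ) ^ 10 := (abs_nonneg _).trans hω
  have e432 : (4 - 3 + 2 : ℕ) = 3 := rfl
  have e430 : (4 - 3 + 0 : ℕ) = 1 := rfl
  have e422 : (4 - 2 + 2 : ℕ) = 4 := rfl
  have e420 : (4 - 2 + 0 : ℕ) = 2 := rfl
  rw [e432, e430, e422, e420, pow_one] at hrow
  have hδ := ghDelta_pos ha
  have hc1 := cNear_nonneg ha
  have hc2 : 0 ≤ cNear1 a := by
    have h := abs_R_diff_le n ha (0 : Pt) (0 : Pt) 0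
    have h' : 0 ≤ cNear1 a / n := (abs_nonneg _).trans h
    have := mul_nonneg h' hn0.le
    rwa [div_mul_cancel₀ _ hn0.ne'] at this
  have hA1 : 0 ≤ ghA1 a + 2 * (cG0 4 + cSplit 4 a) := by
    have := ghA1_nonneg ha; have := cG0_nonneg 4; have := cSplit_nonneg 4 ha; linarith
  have hA0 : 0 ≤ ghA0 a + (cG0 4 + cSplit 4 a) := by
    have := (ghA0_pos ha).le; have := cG0_nonneg 4; have := cSplit_nonneg 4 ha; linarith
  -- the n-free brackets
  set A₁ := ghA1 a + 2 * (cG0 4 + cSplit 4 a) with hA₁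
  set A₀ := ghA0 a + (cG0 4 + cSplit 4 a) with hA₀
  set α₃ := 2 * (Nat.factorial 2) * (2 / ghDelta a) ^ 2 * (1 + 2 * (4 : ℕ) * 3 ^ (4 - 1) * ((Nat.factorial (4 - 1 - 3)) * (4 / ghDelta a) ^ (4 - 1 - 3) * (1 + 4 / ghDelta a))) with hα₃
  set β₃ := 2 * (Nat.factorial 0) * (2 / ghDelta a) ^ 0 * (1 + 2 * (4 : ℕ) * 3 ^ (4 - 1) * ((Nat.factorial (4 - 1 - 3)) * (4 / ghDelta a) ^ (4 - 1 - 3) * (1 + 4 / ghDelta a))) with hβ₃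
  set α₂ := 2 * (Nat.factorial 2) * (2 / ghDelta a) ^ 2 * (1 + 2 * (4 : ℕ) * 3 ^ (4 - 1) * ((Nat.factorial (4 - 1 - 2)) * (4 / ghDelta a) ^ (4 - 1 - 2) * (1 + 4 / ghDelta a))) with hα₂
  set β₂ := 2 * (Nat.factorial 0) * (2 / ghDelta a) ^ 0 * (1 + 2 * (4 : ℕ) * 3 ^ (4 - 1) * ((Nat.factorial (4 - 1 - 2)) * (4 / ghDelta a) ^ (4 - 1 - 2) * (1 + 4 / ghDelta a))) with hβ₂
  have hα₃0 : 0 ≤ α₃ := by rw [hα₃]; positivity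
  have hβ₃0 : 0 ≤ β₃ := by rw [hβ₃]; positivity
  have hα₂0 : 0 ≤ α₂ := by rw [hα₂]; positivity
  have hβ₂0 : 0 ≤ β₂ := by rw [hβ₂]; positivity
  clear_value A₁ A₀ α₃ β₃ α₂ β₂
  refine hrow.trans ?_
  have key : ((n : ℝ) ^ 4)⁻¹ * (((n : ℝ) ^ 8)⁻¹ * (((n : ℝ) - 1) *
      (((n : ℝ) ^ 2)⁻¹ * (cNear a * A₁ * (2 * (α₃ * (n : ℝ) ^ 3) + 2 * (n : ℝ) ^ 2 * (β₃ * (n : ℝ)))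
        + cNear1 a / n * A₀ * (2 * (α₂ * (n : ℝ) ^ 4) + 2 * (n : ℝ) ^ 2 * (β₂ * (n : ℝ) ^ 2))))))
      ≤ ((n : ℝ) ^ 10)⁻¹ * (cNear a * A₁ * (2 * α₃ + 2 * β₃) + cNear1 a * A₀ * (2 * α₂ + 2 * β₂)) := by
    have e : ((n : ℝ) ^ 4)⁻¹ * (((n : ℝ) ^ 8)⁻¹ * (((n : ℝ) - 1) *
        (((n : ℝ) ^ 2)⁻¹ * (cNear a * A₁ * (2 * (α₃ * (n : ℝ) ^ 3) + 2 * (n : ℝ) ^ 2 * (β₃ * (n : ℝ)))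
          + cNear1 a / n * A₀ * (2 * (α₂ * (n : ℝ) ^ 4) + 2 * (n : ℝ) ^ 2 * (β₂ * (n : ℝ) ^ 2))))))
        = (((n : ℝ) - 1) / n) * (((n : ℝ) ^ 10)⁻¹ * (cNear a * A₁ * (2 * α₃ + 2 * β₃) + cNear1 a * A₀ * (2 * α₂ + 2 * β₂))) := by
      field_simp
    rw [e]
    exact mul_le_of_le_one_left (by positivity) ((div_le_one hn0).2 (by linarith))
  have hn1 : (0 : ℝ) ≤ (n : ℝ) - 1 := by
    have : (2 : ℝ) ≤ n := by exact_mod_cast hn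
    linarith
  have hbig : 0 ≤ ((n : ℝ) ^ 4)⁻¹ * (((n : ℝ) ^ 8)⁻¹ * (((n : ℝ) - 1) *
      (((n : ℝ) ^ 2)⁻¹ * (cNear a * A₁ * (2 * (α₃ * (n : ℝ) ^ 3) + 2 * (n : ℝ) ^ 2 * (β₃ * (n : ℝ)))
        + cNear1 a / n * A₀ * (2 * (α₂ * (n : ℝ) ^ 4) + 2 * (n : ℝ) ^ 2 * (β₂ * (n : ℝ) ^ 2)))))) :=
    mul_nonneg (by positivity) (mul_nonneg (by positivity) (mul_nonneg hn1 (by positivity)))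
  calc |ωgh n * (cK n * cQ n)| * (((n : ℝ) ^ 4)⁻¹ * (((n : ℝ) ^ 8)⁻¹ * (((n : ℝ) - 1) *
        (((n : ℝ) ^ 2)⁻¹ * (cNear a * A₁ * (2 * (α₃ * (n : ℝ) ^ 3) + 2 * (n : ℝ) ^ 2 * (β₃ * (n : ℝ)))
          + cNear1 a / n * A₀ * (2 * (α₂ * (n : ℝ) ^ 4) + 2 * (n : ℝ) ^ 2 * (β₂ * (n : ℝ) ^ 2)))))))
      ≤ (k * (n : ℝ) ^ 10) * (((n : ℝ) ^ 10)⁻¹ * (cNear a * A₁ * (2 * α₃ + 2 * β₃) + cNear1 a * A₀ * (2 * α₂ + 2 * β₂))) :=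
        mul_le_mul hω key hbig hkn
    _ = k * (cNear a * A₁ * (2 * α₃ + 2 * β₃) + cNear1 a * A₀ * (2 * α₂ + 2 * β₂)) := by field_simp

end Summit.QuantumFields.BalabanUV.Beta.D1BFx.NeedleGhostBubbleRowMass10

end
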